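import Summits.QuantumFields.YangMills.Theorems.BalabanUVNodesN15KingModelAnalyticDeterminantResponseIntegral
import Summits.QuantumFields.YangMills.Theorems.BalabanUVNodesN15KingModelAnalyticDeterminantMonotone
import Literature.NumberTheory.ModularForms.SiegelLogDetHessian
import Literature.LinearAlgebra.Matrix.NearestPositiveSemidefinite
import HarnessLib

/-!
# BalabanUVNodes ∕ N15 — THE KING-MODEL RUNG (PART Ϯ-g): THE SECOND VARIATION OF THE BLOCK-FIELD VACUUM ENERGY — `∂_t² ln det Δ_t = −tr(Δ_t⁻¹EΔ_t⁻¹E)` along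
# `Δ_t = Δ_eff(V) + t(Δ_eff(U) − Δ_eff(V))` (Klingen's (15) «`d∕dt y⁻¹ = −y⁻¹(dy∕dt)y⁻¹`», Literature `SiegelLogDetHessian` BY NAME, shifted along the segment), with the TWO-SIDED CURVATURE
# `a⁻²·tr(E²) ≤ tr(Δ_t⁻¹EΔ_t⁻¹E) ≤ β♯⁻²·tr(E²)`, `β♯ = am²∕(a+m²)` (trace of products of positive semidefinite matrices on the Loewner interval `[β♯, a]` of PART Ϫ-l), and STRICT negativity for
# `E ≠ 0` (Klingen's positivity) — King's (3.96) at `n = 2`: the `−½tr D²` term, as an exact second derivative with its size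
# (Track A, DAG node N15 = NE2; FAN-OUT v1.1 §N15 s3 «KING-MODEL RUNG … + what the curved case adds»; count-neutral)

HONEST FRAMING.  Count-neutral (cell `pub-ymgap`, seat `pub-ymgap-dag-n15-e` g54; `--supports stmt-QuantumFields-27247 --as helper` = K3ᴬ, KEY MAP v3).  King's one-level comparison model;
`𝕜 = ℝ` in the model section (real-orthogonal backgrounds, as in PART Ϭ-l∕Ϭ-m: the tree's Jacobi∕inverse-derivative lemmas are for `ℝ`-valued paths of an `ℝ`-variable), the curvature
tools §2 for any `RCLike` field; `a, m² > 0`, `c ≥ 0`; finite matrices.  The interpolation is LINEAR IN THE OPERATOR (`Δ_t`), not in the field `A` of King's (3.94); NOT (3.97)–(3.98);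
NOT a node discharge (N15 of record untouched); nothing continuum ∕ ℝ⁴ ∕ OS ∕ Clay.

THE MECHANISM.  (i) §1 Klingen's `hasDerivAt_trace_inv_add_smul_mul` («the elementary formula», at `s = 0`) transported to every point of the line by the substitution `y ↦ W + tE`, `s ↦ s − t`:
★★ `hasDerivAt_trace_inv_affine_mul` (`∂_t tr((W+tE)⁻¹F) = −tr((W+tE)⁻¹E(W+tE)⁻¹F)` wherever `det ≠ 0`), so with PART Ϭ-l (`∂_t ln det = tr((W+tE)⁻¹E)`) the second derivative of
`ln det(W + tE)` is `−tr((W+tE)⁻¹E(W+tE)⁻¹E)`; (ii) §2 for `C ⪰ 0` with `c₀·1 ⪯ C ⪯ c₁·1` and Hermitian `E`: `tr(CECE) = tr((ECE)C)`, `ECE ⪰ 0`, `E² ⪰ 0`, and `Re tr(XP) ≥ 0` for PSD `X, P`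
(Literature `NearestPositiveSemidefinite.re_trace_mul_nonneg`) give ★★ `re_trace_conj_sq_ge`∕`_le`: `c₀²·Re tr(E²) ≤ Re tr(CECE) ≤ c₁²·Re tr(E²)`; (iii) §3 on the segment `Δ_t ∈ [β♯, a]`
(convexity of the Loewner interval from Ϫ-l's endpoint sandwich) and `Δ_t⁻¹ ∈ [a⁻¹, β♯⁻¹]` (Ϭ-k `posSemidef_inv_sub_inv_add_of_posSemidef`) ⟹ ★★★★ **`king_second_variation_bounds`**:
`−β♯⁻²tr(E²) ≤ ∂_t² ln det Δ_t ≤ −a⁻²tr(E²)`; ★★★ `king_second_variation_neg` (`< 0` for `U`'s and `V`'s block-field operators distinct; Klingen `trace_inv_mul_mul_inv_mul_pos`).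

PRIOR TREE ART (by name, not restated): Literature `SiegelLogDetHessian` [Klingen1990 Ch. V §11 (15)] (`hasDerivAt_trace_inv_add_smul_mul`, `trace_inv_mul_mul_inv_mul_pos`),
`NearestPositiveSemidefinite.re_trace_mul_nonneg` [Higham1988], Ϭ-l `hasDerivAt_log_det_effLapU_segment`∕`posDef_effLapU_segment`, Ϭ-k `posSemidef_inv_sub_inv_add_of_posSemidef`,
Ϭ-b `posDef_effLapU`∕`isHermitian_effLapU` (via Ϫ-l), Ϫ-l `re_quadForm_effLapU_ge_sharp`∕`re_quadForm_effLapU_le_coupling`.  Dedup (rg at filing): basename 0 files;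
`hasDerivAt_trace_inv_affine_mul|re_trace_conj_sq_ge|re_trace_conj_sq_le|posSemidef_effLapU_segment_sub_floor|king_second_variation_bounds|king_second_variation_neg` 0 tree files.
Locators: [King1986] (3.94)–(3.96) p.669, (3.89)–(3.90) pp.668–669, (2.14) p.653, (4.33) p.674; [Klingen1990] Ch. V §11 (15) p.141; [Higham1988] §2; [Bernstein2009] Fact 8.10.8.  0 `sorry`, 0 `def`.
-/

noncomputable section

open scoped BigOperators ComplexConjugate ComplexOrder Matrix.Norms.L2Operator
open Finset Matrix

namespace Summit.QuantumFields.YangMills.BalabanUVNodes.N15KingModelRung.Analytic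

open Literature.MathematicalPhysics.QuantumFieldTheory.Balaban1983to89.B5Prop11Plancherel (Tor fine)
open Literature.NumberTheory.ModularForms.SiegelUpperHalfSpace (hasDerivAt_trace_inv_add_smul_mul trace_inv_mul_mul_inv_mul_pos)
open Literature.LinearAlgebra.Matrix.NearestPositiveSemidefinite (re_trace_mul_nonneg)
open Summit.QuantumFields.YangMills.BalabanUVNodes.N15KingModelRung.CovariantBlock (BlockTree effLapU isUnit_effLapU)

/-! ## §1 «The elementary formula» along the whole line: `∂_t tr((W+tE)⁻¹F) = −tr((W+tE)⁻¹E(W+tE)⁻¹F)` -/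

section InverseDeriv

variable {ι : Type*} [Fintype ι] [DecidableEq ι]

/-- ★★ **`∂_t tr((W + tE)⁻¹F) = −tr((W+tE)⁻¹·E·(W+tE)⁻¹·F)`** wherever `det(W + tE) ≠ 0` — Klingen's «elementary formula `d∕dt y⁻¹ = −y⁻¹(dy∕dt)y⁻¹`» (Literature `SiegelLogDetHessian`, at `s = 0`)
transported to the point `t` by `y = W + tE`, `s ↦ s − t`. [cite: Klingen1990, Ch. V §11 (15) p.141; King1986, (3.94)–(3.96) p.669] -/
theorem hasDerivAt_trace_inv_affine_mul (W E F : Matrix ι ι ℝ) {t : ℝ} (hA : (W + t • E).det ≠ 0) :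
    HasDerivAt (fun s : ℝ => ((W + s • E)⁻¹ * F).trace) (-((W + t • E)⁻¹ * E * (W + t • E)⁻¹ * F).trace) t := by
  have h0 := hasDerivAt_trace_inv_add_smul_mul (y := W + t • E) (isUnit_iff_ne_zero.mpr hA) E F
  have h1 : HasDerivAt (fun s : ℝ => ((W + t • E + (s - t) • E)⁻¹ * F).trace) (-((W + t • E)⁻¹ * E * (W + t • E)⁻¹ * F).trace) t := by
    have := HasDerivAt.comp_sub_const (f := fun s : ℝ => ((W + t • E + s • E)⁻¹ * F).trace) t t (by rw [sub_self]; exact h0)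
    exact this
  refine h1.congr_of_eventuallyEq (Filter.Eventually.of_forall fun s => ?_)
  simp only [sub_smul]
  congr 3
  abel

/-- ★★ **THE SECOND DERIVATIVE OF `ln det` ALONG A LINE**: where `det(W+tE) ≠ 0`, the derivative `t ↦ tr((W+tE)⁻¹E)` of `ln|det(W+tE)|` (Ϭ-l `hasDerivAt_log_det_affine`) has itself the derivative
`−tr((W+tE)⁻¹E(W+tE)⁻¹E)` — Klingen's (15) along a line at every point. [cite: Klingen1990, Ch. V §11 (15) p.141; King1986, (3.96) p.669] -/
theorem hasDerivAt_trace_inv_affine_mul_self (W E : Matrix ι ι ℝ) {t : ℝ} (hA : (W + t • E).det ≠ 0) :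
    HasDerivAt (fun s : ℝ => ((W + s • E)⁻¹ * E).trace) (-((W + t • E)⁻¹ * E * (W + t • E)⁻¹ * E).trace) t :=
  hasDerivAt_trace_inv_affine_mul W E E hA

end InverseDeriv

/-! ## §2 Curvature tools: `c₀²·tr(E²) ≤ tr(CECE) ≤ c₁²·tr(E²)` on a Loewner interval -/

section Curvature

variable {𝕜 : Type*} [RCLike 𝕜] {ι : Type*} [Fintype ι] [DecidableEq ι]

omit [DecidableEq ι] in
/-- `tr(CECE) = tr((ECE)·C)`. [folklore] -/
theorem trace_conj_sq_eq (C E : Matrix ι ι 𝕜) : (C * E * C * E).trace = (E * C * E * C).trace := by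
  rw [Matrix.trace_mul_comm, ← Matrix.mul_assoc, ← Matrix.mul_assoc]

omit [DecidableEq ι] in
/-- `ECE ⪰ 0` for `C ⪰ 0` and Hermitian `E`. [folklore] -/
theorem posSemidef_conj_of_isHermitian {C E : Matrix ι ι 𝕜} (hC : C.PosSemidef) (hE : E.IsHermitian) : (E * C * E).PosSemidef := by
  have h := hC.conjTranspose_mul_mul_same E
  rwa [hE.eq] at h

omit [DecidableEq ι] in
/-- `E² ⪰ 0` for Hermitian `E`. [folklore] -/
theorem posSemidef_sq_of_isHermitian {E : Matrix ι ι 𝕜} (hE : E.IsHermitian) : (E * E).PosSemidef := by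
  have h := posSemidef_conjTranspose_mul_self E
  rwa [hE.eq] at h

/-- ★ For PSD `X` and `c₀·1 ⪯ C`: `c₀·Re tr X ≤ Re tr(X·C)` (`Re tr(X(C − c₀1)) ≥ 0`, product of two PSD matrices). [cite: Higham1988, §2; HornJohnson2013, 7.2.P26 §7.2] -/
theorem re_trace_mul_ge_of_loewner {X C : Matrix ι ι 𝕜} (hX : X.PosSemidef) {c₀ : ℝ} (hC : (C - (c₀ : 𝕜) • (1 : Matrix ι ι 𝕜)).PosSemidef) :
    c₀ * RCLike.re X.trace ≤ RCLike.re (X * C).trace := by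
  have h := re_trace_mul_nonneg hX hC
  rw [Matrix.mul_sub, Matrix.trace_sub, map_sub, Matrix.mul_smul, Matrix.mul_one, Matrix.trace_smul, smul_eq_mul, RCLike.re_ofReal_mul] at h
  linarith

/-- ★ For PSD `X` and `C ⪯ c₁·1`: `Re tr(X·C) ≤ c₁·Re tr X`. [cite: Higham1988, §2; HornJohnson2013, 7.2.P26 §7.2] -/
theorem re_trace_mul_le_of_loewner {X C : Matrix ι ι 𝕜} (hX : X.PosSemidef) {c₁ : ℝ} (hC : ((c₁ : 𝕜) • (1 : Matrix ι ι 𝕜) - C).PosSemidef) :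
    RCLike.re (X * C).trace ≤ c₁ * RCLike.re X.trace := by
  have h := re_trace_mul_nonneg hX hC
  rw [Matrix.mul_sub, Matrix.trace_sub, map_sub, Matrix.mul_smul, Matrix.mul_one, Matrix.trace_smul, smul_eq_mul, RCLike.re_ofReal_mul] at h
  linarith

/-- ★★ **LOWER CURVATURE**: `C ⪰ 0`, `c₀·1 ⪯ C` with `c₀ ≥ 0`, `E` Hermitian ⟹ `c₀²·Re tr(E²) ≤ Re tr(CECE)` (`tr(CECE) = tr((ECE)C) ≥ c₀tr(ECE) = c₀tr(CE²) ≥ c₀²tr(E²)`).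
[cite: King1986, (3.96) p.669; Higham1988, §2] -/
theorem re_trace_conj_sq_ge {C E : Matrix ι ι 𝕜} (hC : C.PosSemidef) (hE : E.IsHermitian) {c₀ : ℝ} (hc₀ : 0 ≤ c₀) (hCge : (C - (c₀ : 𝕜) • (1 : Matrix ι ι 𝕜)).PosSemidef) :
    c₀ ^ 2 * RCLike.re (E * E).trace ≤ RCLike.re (C * E * C * E).trace := by
  have h1 := re_trace_mul_ge_of_loewner (posSemidef_conj_of_isHermitian hC hE) hCge
  have h2 := re_trace_mul_ge_of_loewner (posSemidef_sq_of_isHermitian hE) hCge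
  have h2' : c₀ * RCLike.re (E * E).trace ≤ RCLike.re (E * C * E).trace := by
    rw [Matrix.trace_mul_comm (E * C) E, ← Matrix.mul_assoc]; exact h2
  rw [trace_conj_sq_eq]
  nlinarith [mul_le_mul_of_nonneg_left h2' hc₀]

/-- ★★ **UPPER CURVATURE**: `C ⪰ 0`, `C ⪯ c₁·1`, `E` Hermitian ⟹ `Re tr(CECE) ≤ c₁²·Re tr(E²)`. [cite: King1986, (3.96) p.669; Higham1988, §2] -/
theorem re_trace_conj_sq_le {C E : Matrix ι ι 𝕜} (hC : C.PosSemidef) (hE : E.IsHermitian) {c₁ : ℝ} (hc₁ : 0 ≤ c₁) (hCle : ((c₁ : 𝕜) • (1 : Matrix ι ι 𝕜) - C).PosSemidef) :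
    RCLike.re (C * E * C * E).trace ≤ c₁ ^ 2 * RCLike.re (E * E).trace := by
  have h1 := re_trace_mul_le_of_loewner (posSemidef_conj_of_isHermitian hC hE) hCle
  have h2 := re_trace_mul_le_of_loewner (posSemidef_sq_of_isHermitian hE) hCle
  have h2' : RCLike.re (E * C * E).trace ≤ c₁ * RCLike.re (E * E).trace := by
    rw [Matrix.trace_mul_comm (E * C) E, ← Matrix.mul_assoc]; exact h2
  have h0 : 0 ≤ RCLike.re (E * C * E).trace := (RCLike.nonneg_iff.mp (posSemidef_conj_of_isHermitian hC hE).trace_nonneg).1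
  rw [trace_conj_sq_eq]
  nlinarith [mul_le_mul_of_nonneg_left h2' hc₁]

/-- `Re tr(CECE) ≥ 0` for `C ⪰ 0`, `E` Hermitian. [cite: Klingen1990, Ch. V §11 (15) p.141] -/
theorem re_trace_conj_sq_nonneg {C E : Matrix ι ι 𝕜} (hC : C.PosSemidef) (hE : E.IsHermitian) : 0 ≤ RCLike.re (C * E * C * E).trace := by
  rw [trace_conj_sq_eq]
  exact re_trace_mul_nonneg (posSemidef_conj_of_isHermitian hC hE) hC

end Curvature

/-! ## §3 King's block-field operator along the segment: the second variation and its two-sided size -/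

section Model

variable {d : ℕ} {L : ℕ} [NeZero L] (T : BlockTree d L) (M : Fin (d + 1) → ℕ) [hM : ∀ μ, NeZero (M μ)]
variable {n : Type*} [Fintype n] [DecidableEq n] [Nonempty n]
variable {a c m2 : ℝ} (ha : 0 < a) (hc : 0 ≤ c) (hm : 0 < m2)
variable {U V : Tor (fine L M) × Fin (d + 1) → Matrix n n ℝ} (hU : ∀ bd, U bd ∈ Matrix.unitaryGroup n ℝ) (hV : ∀ bd, V bd ∈ Matrix.unitaryGroup n ℝ)
include ha hc hm hU hV

/-- ★★★ **THE SECOND VARIATION OF `ln det Δ_t`**: on `[0,1]`, the slope `t ↦ tr(Δ_t⁻¹E)` (Ϭ-l) has derivative `−tr(Δ_t⁻¹EΔ_t⁻¹E)`, `Δ_t = Δ_eff(V) + tE`, `E = Δ_eff(U) − Δ_eff(V)` —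
King's (3.96) `n = 2` term as an exact second derivative. [cite: King1986, (3.94)–(3.96) p.669, (2.14) p.653; Klingen1990, Ch. V §11 (15) p.141] -/
theorem hasDerivAt_trace_inv_effLapU_segment {t : ℝ} (ht : t ∈ Set.Icc (0 : ℝ) 1) :
    HasDerivAt (fun s : ℝ => ((effLapU T M a c m2 V + s • (effLapU T M a c m2 U - effLapU T M a c m2 V))⁻¹ * (effLapU T M a c m2 U - effLapU T M a c m2 V)).trace)
      (-((effLapU T M a c m2 V + t • (effLapU T M a c m2 U - effLapU T M a c m2 V))⁻¹ * (effLapU T M a c m2 U - effLapU T M a c m2 V)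
          * (effLapU T M a c m2 V + t • (effLapU T M a c m2 U - effLapU T M a c m2 V))⁻¹ * (effLapU T M a c m2 U - effLapU T M a c m2 V)).trace) t :=
  hasDerivAt_trace_inv_affine_mul_self _ _ (posDef_effLapU_segment T M ha hc hm hU hV ht).det_pos.ne'

/-- ★ THE SEGMENT LIES IN THE LOEWNER INTERVAL `[β♯, a]`: `Δ_t − β♯·1 ⪰ 0` (`β♯ = (a⁻¹+m⁻²)⁻¹`; convex combination of Ϫ-l's endpoint floors). [cite: King1986, (2.14) p.653, (4.33) p.674] -/
theorem posSemidef_effLapU_segment_sub_floor {t : ℝ} (ht : t ∈ Set.Icc (0 : ℝ) 1) :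
    (effLapU T M a c m2 V + t • (effLapU T M a c m2 U - effLapU T M a c m2 V) - (a⁻¹ + m2⁻¹)⁻¹ • (1 : Matrix (Tor M × n) (Tor M × n) ℝ)).PosSemidef := by
  obtain ⟨h0, h1⟩ := ht
  have key : ∀ {W : Tor (fine L M) × Fin (d + 1) → Matrix n n ℝ}, (∀ bd, W bd ∈ Matrix.unitaryGroup n ℝ) →
      (effLapU T M a c m2 W - (a⁻¹ + m2⁻¹)⁻¹ • (1 : Matrix (Tor M × n) (Tor M × n) ℝ)).PosSemidef := by
    intro W hW
    refine PosSemidef.of_dotProduct_mulVec_nonneg ((isHermitian_effLapU T M ha hc hm hW).sub (Matrix.isHermitian_one.smul (IsSelfAdjoint.all _))) fun g => ?_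
    have h := re_quadForm_effLapU_ge_sharp T M ha hc hm hW g
    simp only [RCLike.re_to_real] at h
    rw [sub_mulVec, dotProduct_sub, Matrix.smul_mulVec, one_mulVec, dotProduct_smul, smul_eq_mul]
    have e : star g ⬝ᵥ g = ∑ p, ‖g p‖ ^ 2 := by
      simp only [dotProduct, Pi.star_apply, star_trivial, Real.norm_eq_abs, sq_abs]; exact Finset.sum_congr rfl fun p _ => by ring
    rw [e]
    linarith
  have e : effLapU T M a c m2 V + t • (effLapU T M a c m2 U - effLapU T M a c m2 V) - (a⁻¹ + m2⁻¹)⁻¹ • (1 : Matrix (Tor M × n) (Tor M × n) ℝ)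
      = (1 - t) • (effLapU T M a c m2 V - (a⁻¹ + m2⁻¹)⁻¹ • 1) + t • (effLapU T M a c m2 U - (a⁻¹ + m2⁻¹)⁻¹ • 1) := by
    rw [smul_sub, smul_sub, smul_sub, sub_smul, one_smul, sub_smul, one_smul]; abel
  rw [e]
  exact ((key hV).smul (by linarith)).add ((key hU).smul h0)

/-- ★ … and `a·1 − Δ_t ⪰ 0`. [cite: King1986, (2.14) p.653] -/
theorem posSemidef_coupling_sub_effLapU_segment {t : ℝ} (ht : t ∈ Set.Icc (0 : ℝ) 1) :
    (a • (1 : Matrix (Tor M × n) (Tor M × n) ℝ) - (effLapU T M a c m2 V + t • (effLapU T M a c m2 U - effLapU T M a c m2 V))).PosSemidef := by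
  obtain ⟨h0, h1⟩ := ht
  have key : ∀ {W : Tor (fine L M) × Fin (d + 1) → Matrix n n ℝ}, (∀ bd, W bd ∈ Matrix.unitaryGroup n ℝ) →
      (a • (1 : Matrix (Tor M × n) (Tor M × n) ℝ) - effLapU T M a c m2 W).PosSemidef := by
    intro W hW
    refine PosSemidef.of_dotProduct_mulVec_nonneg ((Matrix.isHermitian_one.smul (IsSelfAdjoint.all _)).sub (isHermitian_effLapU T M ha hc hm hW)) fun g => ?_
    have h := re_quadForm_effLapU_le_coupling T M ha hc hm hW g
    simp only [RCLike.re_to_real] at h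
    rw [sub_mulVec, dotProduct_sub, Matrix.smul_mulVec, one_mulVec, dotProduct_smul, smul_eq_mul]
    have e : star g ⬝ᵥ g = ∑ p, ‖g p‖ ^ 2 := by
      simp only [dotProduct, Pi.star_apply, star_trivial, Real.norm_eq_abs, sq_abs]; exact Finset.sum_congr rfl fun p _ => by ring
    rw [e]
    linarith
  have e : a • (1 : Matrix (Tor M × n) (Tor M × n) ℝ) - (effLapU T M a c m2 V + t • (effLapU T M a c m2 U - effLapU T M a c m2 V))
      = (1 - t) • (a • 1 - effLapU T M a c m2 V) + t • (a • 1 - effLapU T M a c m2 U) := by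
    rw [smul_sub, smul_sub, smul_sub, sub_smul, one_smul, sub_smul, one_smul]; abel
  rw [e]
  exact ((key hV).smul (by linarith)).add ((key hU).smul h0)

/-- ★ THE COVARIANCE ALONG THE SEGMENT LIES IN `[a⁻¹, β♯⁻¹]`: `Δ_t⁻¹ − a⁻¹·1 ⪰ 0` and `β♯⁻¹·1 − Δ_t⁻¹ ⪰ 0` (Ϭ-k `posSemidef_inv_sub_inv_add_of_posSemidef`). [cite: King1986, (2.14) p.653, (4.33) p.674; Bernstein2009, Fact 8.10.8] -/
theorem posSemidef_inv_effLapU_segment_sandwich {t : ℝ} (ht : t ∈ Set.Icc (0 : ℝ) 1) :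
    ((effLapU T M a c m2 V + t • (effLapU T M a c m2 U - effLapU T M a c m2 V))⁻¹ - a⁻¹ • (1 : Matrix (Tor M × n) (Tor M × n) ℝ)).PosSemidef
      ∧ ((a⁻¹ + m2⁻¹) • (1 : Matrix (Tor M × n) (Tor M × n) ℝ) - (effLapU T M a c m2 V + t • (effLapU T M a c m2 U - effLapU T M a c m2 V))⁻¹).PosSemidef := by
  set D := effLapU T M a c m2 V + t • (effLapU T M a c m2 U - effLapU T M a c m2 V) with hD
  have hDpd : D.PosDef := posDef_effLapU_segment T M ha hc hm hU hV ht
  have hβ : 0 < (a⁻¹ + m2⁻¹)⁻¹ := by positivity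
  have hinv1 : ∀ {r : ℝ}, r ≠ 0 → (r • (1 : Matrix (Tor M × n) (Tor M × n) ℝ))⁻¹ = r⁻¹ • 1 := fun {r} hr =>
    Matrix.inv_eq_left_inv (by rw [smul_mul_smul_comm, Matrix.one_mul, inv_mul_cancel₀ hr, one_smul])
  constructor
  · -- `Δ_t ⪯ a·1` ⟹ `(a·1)⁻¹ ⪯ Δ_t⁻¹`
    have h := posSemidef_inv_sub_inv_add_of_posSemidef hDpd (posSemidef_coupling_sub_effLapU_segment T M ha hc hm hU hV ht)
    rw [← hD, add_sub_cancel, hinv1 ha.ne'] at h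
    exact h
  · -- `β♯·1 ⪯ Δ_t` ⟹ `Δ_t⁻¹ ⪯ β♯⁻¹·1`
    have hβpd : ((a⁻¹ + m2⁻¹)⁻¹ • (1 : Matrix (Tor M × n) (Tor M × n) ℝ)).PosDef := PosDef.one.smul hβ
    have h := posSemidef_inv_sub_inv_add_of_posSemidef hβpd (posSemidef_effLapU_segment_sub_floor T M ha hc hm hU hV ht)
    rw [← hD, add_sub_cancel, hinv1 hβ.ne', inv_inv] at h
    exact h

/-- ★★★★ **KING's (3.96) AT `n = 2` WITH ITS SIZE — THE TWO-SIDED CURVATURE OF THE BLOCK-FIELD VACUUM ENERGY**: along the segment,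
`−β♯⁻²·tr(E²) ≤ ∂_t² ln det Δ_t = −tr(Δ_t⁻¹EΔ_t⁻¹E) ≤ −a⁻²·tr(E²)`, `β♯ = am²∕(a+m²)` — the second-order term is NEGATIVE with modulus between `a⁻²` and `β♯⁻² = (a⁻¹+m⁻²)²` times the
squared Frobenius size `tr(E²)` of the perturbation. [cite: King1986, (3.94)–(3.96) p.669, (2.14) p.653, (4.33) p.674; Klingen1990, Ch. V §11 (15) p.141] -/
theorem king_second_variation_bounds {t : ℝ} (ht : t ∈ Set.Icc (0 : ℝ) 1) :
    -((a⁻¹ + m2⁻¹) ^ 2 * ((effLapU T M a c m2 U - effLapU T M a c m2 V) * (effLapU T M a c m2 U - effLapU T M a c m2 V)).trace)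
        ≤ -((effLapU T M a c m2 V + t • (effLapU T M a c m2 U - effLapU T M a c m2 V))⁻¹ * (effLapU T M a c m2 U - effLapU T M a c m2 V)
            * (effLapU T M a c m2 V + t • (effLapU T M a c m2 U - effLapU T M a c m2 V))⁻¹ * (effLapU T M a c m2 U - effLapU T M a c m2 V)).trace
      ∧ -((effLapU T M a c m2 V + t • (effLapU T M a c m2 U - effLapU T M a c m2 V))⁻¹ * (effLapU T M a c m2 U - effLapU T M a c m2 V)
            * (effLapU T M a c m2 V + t • (effLapU T M a c m2 U - effLapU T M a c m2 V))⁻¹ * (effLapU T M a c m2 U - effLapU T M a c m2 V)).trace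
        ≤ -(a⁻¹ ^ 2 * ((effLapU T M a c m2 U - effLapU T M a c m2 V) * (effLapU T M a c m2 U - effLapU T M a c m2 V)).trace) := by
  set D := effLapU T M a c m2 V + t • (effLapU T M a c m2 U - effLapU T M a c m2 V) with hD
  set E := effLapU T M a c m2 U - effLapU T M a c m2 V with hE
  have hDpd : D.PosDef := posDef_effLapU_segment T M ha hc hm hU hV ht
  have hC : D⁻¹.PosSemidef := hDpd.inv.posSemidef
  have hEh : E.IsHermitian := (isHermitian_effLapU T M ha hc hm hU).sub (isHermitian_effLapU T M ha hc hm hV)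
  obtain ⟨hlo, hhi⟩ := posSemidef_inv_effLapU_segment_sandwich T M ha hc hm hU hV ht
  have h1 := re_trace_conj_sq_ge hC hEh (inv_nonneg.mpr ha.le) (by simpa using hlo)
  have h2 := re_trace_conj_sq_le hC hEh (by positivity : (0 : ℝ) ≤ a⁻¹ + m2⁻¹) (by simpa using hhi)
  simp only [RCLike.re_to_real] at h1 h2
  constructor <;> linarith

/-- ★★★ **STRICT CONCAVITY**: if the two block-field operators differ (`Δ_eff(U) ≠ Δ_eff(V)`), the second variation is STRICTLY NEGATIVE at every point of the segment
(Klingen's positivity `tr(y⁻¹αy⁻¹α) > 0` for symmetric `α ≠ 0`, Literature `trace_inv_mul_mul_inv_mul_pos`). [cite: Klingen1990, Ch. V §11 (15) p.141; King1986, (3.96) p.669] -/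
theorem king_second_variation_neg (hne : effLapU T M a c m2 U ≠ effLapU T M a c m2 V) {t : ℝ} (ht : t ∈ Set.Icc (0 : ℝ) 1) :
    -((effLapU T M a c m2 V + t • (effLapU T M a c m2 U - effLapU T M a c m2 V))⁻¹ * (effLapU T M a c m2 U - effLapU T M a c m2 V)
        * (effLapU T M a c m2 V + t • (effLapU T M a c m2 U - effLapU T M a c m2 V))⁻¹ * (effLapU T M a c m2 U - effLapU T M a c m2 V)).trace < 0 := by
  have hEs : (effLapU T M a c m2 U - effLapU T M a c m2 V).IsSymm := by
    have h := (isHermitian_effLapU T M ha hc hm hU).sub (isHermitian_effLapU T M ha hc hm hV)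
    simpa [Matrix.IsHermitian, Matrix.conjTranspose_eq_transpose_of_trivial, Matrix.IsSymm] using h
  have h := trace_inv_mul_mul_inv_mul_pos (posDef_effLapU_segment T M ha hc hm hU hV ht) hEs (sub_ne_zero.mpr hne)
  linarith

end Model

end Summit.QuantumFields.YangMills.BalabanUVNodes.N15KingModelRung.Analytic

end
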